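import Summits.Ventures.LatticeQCDFlow.Scaling.ReplicaExchangeFiniteSampler
import Literature.Probability.MarkovChains.ProductChainSpectralGap

/-!
HONEST FRAMING: exact (Metropolis-corrected) sampling algorithms for lattice gauge theory; figures
of merit are autocorrelation/cost numbers at stated couplings and volumes; no continuum-physics
claim.

# ProductChainModeRestriction — THE PRODUCT REPLICA UPDATE RESTRICTED TO A MODE ASSIGNMENT IS THE PRODUCT OF THE
# MODE-RESTRICTED UPDATES: off the diagonal `(P̃)_{mode∘x = i} = ⊗_k (M_k)_{A_{i_k}}`, the conditioned product law is
# the product of the conditioned laws, hence (Levin–Peres Cor. 12.13 tensorisation, PROVED in the tree) the restriction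
# chains of `prodKernel w M` along the blocks `x ↦ mode ∘ x` have Poincaré constant `≥ min_k w_k·γ_A`
# (lean-2 GEN-17, ours)

Venture-side (OURS).  Cell `lqcd-flow` (pub-lqcd), unit `pub-lqcd-lean-2-g17`, 2026-08-25.  Foundation for the
replica-exchange ("modes as blocks") counterpart of `Scaling/SimulatedTemperingModeGap`, which chapter Y left NOT
CLAIMED: for replica exchange the natural blocks are the MODE ASSIGNMENTS `i : Fin (K+1) → J` of all replicas, and the
restriction chain of the product replica update `prodKernel w M` (`Scaling/ReplicaExchangeFiniteSampler`,
Literature `ProductChains`) to the block `{x : mode ∘ x = i}` must be identified with the product chain of the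
mode-restricted single-replica updates — then the tensorisation of the Poincaré inequality
(`Literature/Probability/MarkovChains/ProductChainSpectralGap`, `prodKernel_poincare`) delivers the restriction
Poincaré constant from the within-mode constants `γ_A` of chapter Y.  (The projection chain of that decomposition —
an interchange process of mode labels along the ladder fed at the hot end — is NOT treated here.)

## What is proved (finite configuration space `S`, `mode : S → J`, `K+1` replicas)

* §1 `dirichletForm_congr_offDiag` — Dirichlet forms only see off-diagonal entries;
  **`restriction_prodKernel_offDiag`** — for `x ≠ y`,
  `restrictionChain (prodKernel w M) (mode ∘ ·) x y = prodKernel w (fun k => restrictionChain (M k) mode) x y`.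
* §2 **`blockMass_tensorFun_modes`** — `π̃{mode ∘ x = i} = Π_k μ_k(A_{i_k})`;
  **`blockLaw_tensorFun_modes`** — the product law conditioned on the assignment `i` is the product of the `μ_k`
  conditioned on `A_{i_k}` (pointwise).
* §4 (the replica-exchange SAMPLER `ptFinSampler t μ M` along the blocks `(τ, mode ∘ x)`): `ptFinModes_blockMass`
  (`π̄(τ,i) = (K+1)⁻¹Π_kμ_k(A_{i_k})`), `ptFinModes_lawVariance_blockLaw`, **`ptFinModes_dirichletForm_restriction_ge`**
  (the restriction chain contains the restricted product update slowed by `1−t`; same-mode swaps only add),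
  **`ptFinModes_restriction_poincare`** — restriction Poincaré constant `(1−t)γ_A/(K+1)` for EVERY block: the
  restriction half of the replica-exchange decomposition, from the within-mode constants alone.
* §3 **`prodKernel_restriction_poincare`** — if every `(M_k)_{A_j}` has Poincaré constant `γ_A` for
  `μ_k(·|A_j)` (the hypothesis `hgapA` of `Scaling/SimulatedTemperingModeGap`), `w ≥ 0`, `c ≤ w_k γ_A` for all `k`,
  every mode nonempty and `μ_k > 0`, then for every assignment `i` and every `f`:
  `c·Var_{π̃(·|i)}(f) ≤ 𝓔_{π̃(·|i)}(restrictionChain (prodKernel w M) (mode ∘ ·); f)`; with uniform weights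
  (`prodKernel_restriction_poincare_uniform`): constant `γ_A/(K+1)`.

NOT CLAIMED: the projection chain / the full replica-exchange gap floor; general configuration spaces; anything
measured.  Literature grade (cell rule): ELEMENTARY identities + the tree's tensorisation theorem; nothing cited as a
fact; no new bib keys.
-/

noncomputable section

open Finset Function
open Literature.Probability.MarkovChains
open Literature.Probability.MarkovChains.Decomposition

namespace Summit.Ventures.LatticeQCDFlow.Scaling

/-! ## §1 Off-diagonal identity -/

section OffDiag

variable {X : Type*} [Fintype X]

/-- **Dirichlet forms only see off-diagonal entries.** [ours] -/
theorem dirichletForm_congr_offDiag (π : X → ℝ) {P Q : Matrix X X ℝ} (h : ∀ x y, x ≠ y → P x y = Q x y)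
    (f : X → ℝ) : dirichletForm π P f = dirichletForm π Q f := by
  unfold dirichletForm
  congr 1
  refine sum_congr rfl fun x _ => sum_congr rfl fun y _ => ?_
  by_cases hxy : x = y
  · subst hxy; simp
  · rw [h x y hxy]

end OffDiag

variable {S J : Type*} [Fintype S] [DecidableEq S] [DecidableEq J] {K : ℕ}
  {μ : Fin (K + 1) → S → ℝ} {M : Fin (K + 1) → S → S → ℝ} {mode : S → J} {w : Fin (K + 1) → ℝ}

omit [Fintype S] [DecidableEq S] [DecidableEq J] in
/-- After a one-coordinate move, the assignment is unchanged iff the moved coordinate kept its mode. [ours] -/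
theorem modes_update_eq_iff (x : Fin (K + 1) → S) (k : Fin (K + 1)) (v : S) :
    (mode ∘ update x k v = mode ∘ x) ↔ mode v = mode (x k) := by
  constructor
  · intro h
    have := congrFun h k
    simpa using this
  · intro h
    funext i
    by_cases hik : i = k
    · subst hik; simpa using h
    · simp [update_of_ne hik]

/-- **Off the diagonal, the restriction of the product update to a mode assignment is the product of the
mode-restricted updates.** [ours] -/
theorem restriction_prodKernel_offDiag {x y : Fin (K + 1) → S} (hxy : x ≠ y) :
    restrictionChain (prodKernel w M) (fun z : Fin (K + 1) → S => mode ∘ z) x y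
      = prodKernel w (fun k => restrictionChain (M k) mode) x y := by
  rw [restrictionChain_apply_of_ne _ _ (Ne.symm hxy), prodKernel_apply, prodKernel_apply]
  by_cases hb : (mode ∘ y) = (mode ∘ x)
  · rw [if_pos hb]
    refine sum_congr rfl fun k _ => ?_
    congr 1
    unfold coordKernel
    by_cases hy : y = update x k (y k)
    · rw [if_pos hy, if_pos hy]
      have hyk : y k ≠ x k := by
        intro e
        apply hxy
        rw [hy, e, update_eq_self]
      beta_reduce
      rw [restrictionChain_apply_of_ne _ _ hyk]
      have hm : mode (y k) = mode (x k) := by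
        have := (modes_update_eq_iff (mode := mode) x k (y k)).mp (by rw [← hy]; exact hb)
        exact this
      rw [if_pos hm]
    · rw [if_neg hy, if_neg hy]
  · rw [if_neg hb]
    symm
    refine Finset.sum_eq_zero fun k _ => ?_
    unfold coordKernel
    by_cases hy : y = update x k (y k)
    · rw [if_pos hy]
      have hyk : y k ≠ x k := by
        intro e
        apply hxy
        rw [hy, e, update_eq_self]
      beta_reduce
      rw [restrictionChain_apply_of_ne _ _ hyk]
      have hm : ¬ mode (y k) = mode (x k) := by
        intro hm
        apply hb
        rw [hy]
        exact (modes_update_eq_iff (mode := mode) x k (y k)).mpr hm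
      rw [if_neg hm, mul_zero]
    · rw [if_neg hy, mul_zero]

/-! ## §2 The conditioned product law is the product of the conditioned laws -/

omit [DecidableEq S] in
/-- **`π̃{mode ∘ x = i} = Π_k μ_k(A_{i_k})`.** [ours] -/
theorem blockMass_tensorFun_modes (i : Fin (K + 1) → J) :
    blockMass (tensorFun μ) (fun z : Fin (K + 1) → S => mode ∘ z) i = ∏ k, blockMass (μ k) mode (i k) := by
  unfold blockMass block
  rw [Finset.sum_filter]
  have hind : ∀ x : Fin (K + 1) → S, (if mode ∘ x = i then tensorFun μ x else 0)
      = tensorFun (fun k u => if mode u = i k then μ k u else 0) x := by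
    intro x
    by_cases hx : mode ∘ x = i
    · rw [if_pos hx]
      unfold tensorFun
      refine Finset.prod_congr rfl fun k _ => ?_
      have : mode (x k) = i k := congrFun hx k
      simp [this]
    · rw [if_neg hx]
      have : ∃ k, mode (x k) ≠ i k := by
        by_contra hall
        push Not at hall
        exact hx (funext hall)
      obtain ⟨k, hk⟩ := this
      unfold tensorFun
      exact (Finset.prod_eq_zero (mem_univ k) (by simp [hk])).symm
  simp_rw [hind]
  rw [sum_tensorFun]
  refine Finset.prod_congr rfl fun k _ => ?_
  rw [Finset.sum_filter]

omit [DecidableEq S] in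
/-- **The product law conditioned on the assignment `i` is the product of the conditioned laws** (pointwise).
[ours] -/
theorem blockLaw_tensorFun_modes (i : Fin (K + 1) → J) (x : Fin (K + 1) → S) :
    blockLaw (tensorFun μ) (fun z : Fin (K + 1) → S => mode ∘ z) i x
      = tensorFun (fun k => blockLaw (μ k) mode (i k)) x := by
  unfold blockLaw
  rw [blockMass_tensorFun_modes]
  by_cases hx : mode ∘ x = i
  · rw [if_pos hx]
    unfold tensorFun
    rw [← Finset.prod_div_distrib]
    refine Finset.prod_congr rfl fun k _ => ?_
    have : mode (x k) = i k := congrFun hx k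
    simp [this]
  · rw [if_neg hx]
    have : ∃ k, mode (x k) ≠ i k := by
      by_contra hall
      push Not at hall
      exact hx (funext hall)
    obtain ⟨k, hk⟩ := this
    unfold tensorFun
    exact (Finset.prod_eq_zero (mem_univ k) (by simp [hk])).symm

/-! ## §3 The restriction Poincaré constant by tensorisation -/

/-- **THE RESTRICTION CHAINS OF THE PRODUCT UPDATE ALONG MODE ASSIGNMENTS HAVE POINCARÉ CONSTANT `≥ min_k w_kγ_A`:**
for every assignment `i` and every `f`,
`c·Var_{π̃(·|i)}(f) ≤ 𝓔_{π̃(·|i)}((prodKernel w M)_{i}; f)` whenever `c ≤ w_kγ_A` for all `k` and each mode-restricted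
update `(M_k)_{A_j}` satisfies `γ_A·Var_{μ_k(·|A_j)} ≤ 𝓔`. [ours] -/
theorem prodKernel_restriction_poincare (hμ : ∀ k x, 0 < μ k x) (hmode : Function.Surjective mode)
    (hM : ∀ k, IsRowStochastic (M k)) (hw0 : ∀ k, 0 ≤ w k) {γA c : ℝ} (hc : ∀ k, c ≤ w k * γA)
    (hgapA : ∀ k j, ∀ h : S → ℝ, γA * lawVariance (blockLaw (μ k) mode j) h
      ≤ dirichletForm (blockLaw (μ k) mode j) (restrictionChain (M k) mode) h)
    (i : Fin (K + 1) → J) (f : (Fin (K + 1) → S) → ℝ) :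
    c * lawVariance (blockLaw (tensorFun μ) (fun z : Fin (K + 1) → S => mode ∘ z) i) f
      ≤ dirichletForm (blockLaw (tensorFun μ) (fun z : Fin (K + 1) → S => mode ∘ z) i)
          (restrictionChain (prodKernel w M) (fun z : Fin (K + 1) → S => mode ∘ z)) f := by
  have hlaw : blockLaw (tensorFun μ) (fun z : Fin (K + 1) → S => mode ∘ z) i
      = tensorFun (fun k => blockLaw (μ k) mode (i k)) := funext (blockLaw_tensorFun_modes i)
  rw [hlaw, dirichletForm_congr_offDiag _ (fun x y hxy => restriction_prodKernel_offDiag hxy) f]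
  refine prodKernel_poincare (K + 1) (X := fun _ => S) (π := fun k => blockLaw (μ k) mode (i k))
    (P := fun k => restrictionChain (M k) mode) (w := w) (γ := fun _ => γA)
    (fun k u => blockLaw_nonneg (fun v => (hμ k v).le) mode (i k) u)
    (fun k => sum_blockLaw ((blockMass_pos (hμ k) hmode (i k)).ne'))
    (fun k u v => (restrictionChain_isRowStochastic (hM k) mode).1 u v) hw0 hc (fun k h => hgapA k (i k) h) f

/-- **Uniform weights `w_k = 1/(K+1)` (one uniformly chosen replica per step): restriction Poincaré constant
`γ_A/(K+1)`.** [ours] -/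
theorem prodKernel_restriction_poincare_uniform (hμ : ∀ k x, 0 < μ k x) (hmode : Function.Surjective mode)
    (hM : ∀ k, IsRowStochastic (M k)) {γA : ℝ}
    (hgapA : ∀ k j, ∀ h : S → ℝ, γA * lawVariance (blockLaw (μ k) mode j) h
      ≤ dirichletForm (blockLaw (μ k) mode j) (restrictionChain (M k) mode) h)
    (i : Fin (K + 1) → J) (f : (Fin (K + 1) → S) → ℝ) :
    γA / (K + 1) * lawVariance (blockLaw (tensorFun μ) (fun z : Fin (K + 1) → S => mode ∘ z) i) f
      ≤ dirichletForm (blockLaw (tensorFun μ) (fun z : Fin (K + 1) → S => mode ∘ z) i)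
          (restrictionChain (prodKernel (fun _ : Fin (K + 1) => (1 : ℝ) / (K + 1)) M)
            (fun z : Fin (K + 1) → S => mode ∘ z)) f :=
  prodKernel_restriction_poincare hμ hmode hM (fun _ => by positivity)
    (fun _ => by rw [one_div_mul_eq_div]) hgapA i f

/-! ## §4 The replica-exchange sampler along the blocks (tag, mode assignment) -/

section Sampler

variable {t : ℝ}

omit [DecidableEq S] in
/-- An indicator of the block `(τ, i)` restricts a sum over the replica-exchange state space to the tag `τ` and the
assignment `i`. [ours] -/
theorem sum_ite_tagModes_eq (τ : Fin (K + 1)) (i : Fin (K + 1) → J) (F : Fin (K + 1) × (Fin (K + 1) → S) → ℝ) :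
    ∑ q : Fin (K + 1) × (Fin (K + 1) → S), (if (q.1, mode ∘ q.2) = (τ, i) then F q else 0)
      = ∑ y : Fin (K + 1) → S, if mode ∘ y = i then F (τ, y) else 0 := by
  rw [Fintype.sum_prod_type, Finset.sum_comm]
  refine sum_congr rfl fun y _ => ?_
  have h : ∀ σ : Fin (K + 1),
      ((((σ, y) : Fin (K + 1) × (Fin (K + 1) → S)).1, mode ∘ ((σ, y) : Fin (K + 1) × (Fin (K + 1) → S)).2) = (τ, i))
        ↔ (σ = τ ∧ mode ∘ y = i) := fun σ => by
    rw [Prod.mk.injEq]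
  simp_rw [if_congr (h _) rfl rfl, ite_and]
  rw [Finset.sum_ite_eq' univ τ, if_pos (mem_univ _)]

omit [DecidableEq S] in
/-- **Block masses along (tag, assignment):** `π̄(τ, i) = (K+1)⁻¹·Π_k μ_k(A_{i_k})`. [ours] -/
theorem ptFinModes_blockMass (τ : Fin (K + 1)) (i : Fin (K + 1) → J) :
    blockMass (ptFinLaw μ) (fun p : Fin (K + 1) × (Fin (K + 1) → S) => (p.1, mode ∘ p.2)) (τ, i)
      = blockMass (tensorFun μ) (fun z : Fin (K + 1) → S => mode ∘ z) i / (K + 1) := by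
  unfold blockMass block
  rw [Finset.sum_filter, Finset.sum_filter, sum_ite_tagModes_eq τ i, Finset.sum_div]
  refine sum_congr rfl fun y _ => ?_
  unfold ptFinLaw
  split_ifs <;> simp

omit [DecidableEq S] in
/-- Integrals against the block law of `(τ, i)` are integrals of the slice against the conditioned product law.
[ours] -/
theorem sum_ptFinModes_blockLaw_mul (τ : Fin (K + 1)) (i : Fin (K + 1) → J)
    (g : Fin (K + 1) × (Fin (K + 1) → S) → ℝ) :
    ∑ p, blockLaw (ptFinLaw μ) (fun p : Fin (K + 1) × (Fin (K + 1) → S) => (p.1, mode ∘ p.2)) (τ, i) p * g p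
      = ∑ y, blockLaw (tensorFun μ) (fun z : Fin (K + 1) → S => mode ∘ z) i y * g (τ, y) := by
  rw [sum_blockLaw_mul, sum_blockLaw_mul, ptFinModes_blockMass]
  unfold block
  rw [Finset.sum_filter, Finset.sum_filter, sum_ite_tagModes_eq τ i]
  have h : ∑ y : Fin (K + 1) → S, (if mode ∘ y = i then ptFinLaw μ (τ, y) * g (τ, y) else 0)
      = (∑ y : Fin (K + 1) → S, (if mode ∘ y = i then tensorFun μ y * g (τ, y) else 0)) / (K + 1) := by
    rw [Finset.sum_div]
    refine sum_congr rfl fun y _ => ?_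
    unfold ptFinLaw
    split_ifs
    · ring
    · simp
  rw [h]
  exact div_div_div_cancel_right₀ (by positivity) _ _

omit [DecidableEq S] in
/-- The block variance of `(τ, i)` is the conditioned product-law variance of the slice. [ours] -/
theorem ptFinModes_lawVariance_blockLaw (τ : Fin (K + 1)) (i : Fin (K + 1) → J)
    (f : Fin (K + 1) × (Fin (K + 1) → S) → ℝ) :
    lawVariance (blockLaw (ptFinLaw μ) (fun p : Fin (K + 1) × (Fin (K + 1) → S) => (p.1, mode ∘ p.2)) (τ, i)) f
      = lawVariance (blockLaw (tensorFun μ) (fun z : Fin (K + 1) → S => mode ∘ z) i) (fun y => f (τ, y)) := by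
  unfold lawVariance lawMean
  rw [sum_ptFinModes_blockLaw_mul τ i f]
  exact sum_ptFinModes_blockLaw_mul τ i _

/-- **The restriction chain of block `(τ, i)` of the replica-exchange sampler contains the product replica update
restricted to the assignment, slowed by `1 − t`** (same-mode swaps only add): its Dirichlet form dominates
`(1−t)·𝓔_{π̃(·|i)}((prodKernel (K+1)⁻¹ M)_{i}; f(τ,·))`. [ours] -/
theorem ptFinModes_dirichletForm_restriction_ge (hμ : ∀ k x, 0 < μ k x) (ht0 : 0 ≤ t)
    (τ : Fin (K + 1)) (i : Fin (K + 1) → J) (f : Fin (K + 1) × (Fin (K + 1) → S) → ℝ) :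
    (1 - t) * dirichletForm (blockLaw (tensorFun μ) (fun z : Fin (K + 1) → S => mode ∘ z) i)
        (restrictionChain (prodKernel (fun _ : Fin (K + 1) => (1 : ℝ) / (K + 1)) M)
          (fun z : Fin (K + 1) → S => mode ∘ z)) (fun y => f (τ, y))
      ≤ dirichletForm (blockLaw (ptFinLaw μ) (fun p : Fin (K + 1) × (Fin (K + 1) → S) => (p.1, mode ∘ p.2)) (τ, i))
          (restrictionChain (ptFinSampler t μ M) (fun p : Fin (K + 1) × (Fin (K + 1) → S) => (p.1, mode ∘ p.2))) f := by
  unfold dirichletForm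
  rw [← mul_assoc, mul_comm (1 - t), mul_assoc]
  refine mul_le_mul_of_nonneg_left ?_ (by norm_num)
  simp_rw [mul_assoc, restrictionChain_mul_sq_sub, ← Finset.mul_sum]
  rw [sum_ptFinModes_blockLaw_mul τ i, Finset.mul_sum]
  refine sum_le_sum fun x _ => ?_
  rw [← mul_assoc, mul_comm (1 - t), mul_assoc]
  refine mul_le_mul_of_nonneg_left ?_ (blockLaw_nonneg (fun y => (tensorFun_pos hμ y).le) _ _ _)
  simp_rw [ite_mul, zero_mul]
  have e : ∀ q : Fin (K + 1) × (Fin (K + 1) → S),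
      (if (q.1, mode ∘ q.2) = ((τ, x).1, mode ∘ (τ, x).2) then ptFinSampler t μ M (τ, x) q * (f (τ, x) - f q) ^ 2 else 0)
        = if (q.1, mode ∘ q.2) = (τ, mode ∘ x) then ptFinSampler t μ M (τ, x) q * (f (τ, x) - f q) ^ 2 else 0 :=
    fun q => rfl
  simp_rw [e]
  rw [sum_ite_tagModes_eq τ (mode ∘ x) (fun q => ptFinSampler t μ M (τ, x) q * (f (τ, x) - f q) ^ 2), Finset.mul_sum]
  refine sum_le_sum fun y _ => ?_
  have hR : restrictionChain (prodKernel (fun _ : Fin (K + 1) => (1 : ℝ) / (K + 1)) M)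
        (fun z : Fin (K + 1) → S => mode ∘ z) x y * (f (τ, x) - f (τ, y)) ^ 2
      = (if mode ∘ y = mode ∘ x then prodKernel (fun _ : Fin (K + 1) => (1 : ℝ) / (K + 1)) M x y else 0)
          * (f (τ, x) - f (τ, y)) ^ 2 :=
    restrictionChain_mul_sq_sub _ _ (fun z => f (τ, z)) x y
  rw [hR]
  by_cases hy : mode ∘ y = mode ∘ x
  · rw [if_pos hy, if_pos hy, ptFinSampler_apply, add_mul, ptFinUpdate_apply, if_pos rfl, mul_assoc]
    have hsw : 0 ≤ t * ptFinSwap μ (τ, x) (τ, y) * (f (τ, x) - f (τ, y)) ^ 2 :=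
      mul_nonneg (mul_nonneg ht0 ((ptFinSwap_isRowStochastic hμ).1 _ _)) (sq_nonneg _)
    linarith
  · rw [if_neg hy, if_neg hy, zero_mul, mul_zero]

/-- **RESTRICTION POINCARÉ CONSTANT OF THE REPLICA-EXCHANGE SAMPLER ALONG (TAG, MODE ASSIGNMENT):**
`((1−t)γ_A/(K+1))·Var_{π_(τ,i)}(f) ≤ 𝓔_{π_(τ,i)}(P_(τ,i); f)` for every block — from the within-mode constants `γ_A`
alone. [ours] -/
theorem ptFinModes_restriction_poincare (hμ : ∀ k x, 0 < μ k x) (hmode : Function.Surjective mode)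
    (hM : ∀ k, IsRowStochastic (M k)) (ht0 : 0 ≤ t) (ht1 : t ≤ 1) {γA : ℝ}
    (hgapA : ∀ k j, ∀ h : S → ℝ, γA * lawVariance (blockLaw (μ k) mode j) h
      ≤ dirichletForm (blockLaw (μ k) mode j) (restrictionChain (M k) mode) h)
    (b : Fin (K + 1) × (Fin (K + 1) → J)) (f : Fin (K + 1) × (Fin (K + 1) → S) → ℝ) :
    (1 - t) * (γA / (K + 1))
        * lawVariance (blockLaw (ptFinLaw μ) (fun p : Fin (K + 1) × (Fin (K + 1) → S) => (p.1, mode ∘ p.2)) b) f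
      ≤ dirichletForm (blockLaw (ptFinLaw μ) (fun p : Fin (K + 1) × (Fin (K + 1) → S) => (p.1, mode ∘ p.2)) b)
          (restrictionChain (ptFinSampler t μ M) (fun p : Fin (K + 1) × (Fin (K + 1) → S) => (p.1, mode ∘ p.2))) f := by
  obtain ⟨τ, i⟩ := b
  rw [ptFinModes_lawVariance_blockLaw, mul_assoc]
  refine le_trans (mul_le_mul_of_nonneg_left
    (prodKernel_restriction_poincare_uniform hμ hmode hM hgapA i (fun y => f (τ, y))) (by linarith)) ?_
  exact ptFinModes_dirichletForm_restriction_ge hμ ht0 τ i f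

end Sampler

end Summit.Ventures.LatticeQCDFlow.Scaling

end
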